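import Literature.Topology.FourManifolds.LefschetzBaseRegular
import Mathlib.Analysis.Complex.ExponentialBounds
import Mathlib.Analysis.Calculus.ContDiff.Deriv
import Mathlib.Analysis.Calculus.LocalExtr.Basic
import HarnessLib

/-!
# A convex replacement for the cut-off of the Lefschetz base

Topic `Literature/Topology/FourManifolds`; namespace `Literature.Topology.FourManifolds.LefschetzBase`.
A sequel of `LefschetzBaseModel.lean`/`LefschetzBaseRegular.lean` (cut-off
`eta s = expNegInvGlue (s - 4)`).  Everything is **proved**; the two definitions (`cbump`,
`convexProfile`) are explicit auxiliary functions, no named fact is introduced.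

The cut-off `eta(s) = exp(-1/(s-4))` of the base `Base g = {‖w‖² + eta(‖x‖²) ≤ 1/4}` is NOT
convex beyond `s - 4 = 1/2` (`eta'' = eta (1 - 2u)/u⁴`, `u = s - 4`), so `eta(‖x‖²)` is not
plurisubharmonic there; the strictly pseudoconvex model of the base (base case of
`Literature.Geometry.Symplectic.palf_stein_supportedByBoundaryOpenBook`; stages 1–2 in
`LefschetzBaseProfileChange.lean`, `LefschetzBaseRounding.lean`) uses instead the
**convex profile**

  `Θ(s) = eta(s) + 2000 · Λ(s - 17/4)`,  `Λ(v) = v² · expNegInvGlue(v) = v² e^{-1/v}` (`v > 0`),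

which this file provides together with exactly the properties consumed by those stages and by
the Levi-form computation (`FlatLeviNormSq.levi_comp_norm_sq_of_linear`):

* `contDiff_convexProfile`; `convexProfile_of_le` (`Θ = eta` on `s ≤ 17/4`, in particular
  `convexProfile_of_le_four`: `Θ = 0` on `s ≤ 4`); `eta_le_convexProfile`;
* `deriv_convexProfile_nonneg` (`Θ' ≥ 0`), `deriv_convexProfile_pos` (`Θ' > 0` for `s > 4`);
* `convexProfile_seventeen_quarters_le` (`Θ(17/4) = e^{-4} ≤ 1/32`);
* `deriv_deriv_convexProfile_nonneg` (**`Θ'' ≥ 0`**: for `u ≤ 1/2` both summands are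
  convex; for `u ≥ 1/2`, `eta'' = e^{-1/u}(u⁻⁴ - 2u⁻³) ≥ -32` while
  `Λ''(v) = e^{-1/v}((2v+1)/v² + 2) ≥ 2e^{-4} ≥ 1/30` for `v = u - 1/4 ≥ 1/4`), whence
  `levi_coeff_convexProfile_nonneg`: `Θ'(s) + s Θ''(s) ≥ 0` for `0 ≤ s`.

## References

* K. Cieliebak, Ya. Eliashberg, *From Stein to Weinstein and Back*, AMS Coll. Publ. 59 (2012),
  Ch. 2 (`φ(|z|²)` is `i`-convex for `φ` convex and increasing). [CieliebakEliashberg2012]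
-/

noncomputable section

open scoped Topology ContDiff
open Set Filter Real

namespace Literature.Topology.FourManifolds

namespace LefschetzBase

/-! ### §1 The convex bump `Λ(v) = v² e^{-1/v}` -/

/-- The convex bump `Λ(v) = v² · expNegInvGlue v` (`= v² e^{-1/v}` for `v > 0`, `= 0` for
`v ≤ 0`). [folklore] -/
def cbump (v : ℝ) : ℝ := v ^ 2 * expNegInvGlue v

/-- `Λ` is smooth. [folklore] -/
theorem contDiff_cbump : ContDiff ℝ ∞ cbump := (contDiff_id.pow 2).mul expNegInvGlue.contDiff

/-- `Λ = 0` on `v ≤ 0`. [folklore] -/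
theorem cbump_of_nonpos {v : ℝ} (hv : v ≤ 0) : cbump v = 0 := by
  simp [cbump, expNegInvGlue.zero_of_nonpos hv]

/-- `Λ ≥ 0`. [folklore] -/
theorem cbump_nonneg (v : ℝ) : 0 ≤ cbump v := mul_nonneg (sq_nonneg _) (expNegInvGlue.nonneg _)

/-- `Λ(v) = v² e^{-1/v}` for `v > 0`. [folklore] -/
theorem cbump_eq_of_pos {v : ℝ} (hv : 0 < v) : cbump v = v ^ 2 * exp (-v⁻¹) := by
  simp [cbump, expNegInvGlue, not_le.2 hv]

/-- **`Λ'(v) = e^{-1/v} (2v + 1)`** for `v > 0`. [folklore] -/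
theorem hasDerivAt_cbump_of_pos {v : ℝ} (hv : 0 < v) :
    HasDerivAt cbump (exp (-v⁻¹) * (2 * v + 1)) v := by
  have hne : v ≠ 0 := hv.ne'
  have h1 : HasDerivAt (fun u : ℝ => -u⁻¹) (v⁻¹ ^ 2) v := by
    have h0 := ((hasDerivAt_id v).inv hne).neg
    have he : -(-(1 : ℝ) / id v ^ 2) = v⁻¹ ^ 2 := by
      simp only [id_eq, neg_div, neg_neg, one_div, inv_pow]
    exact h0.congr_deriv he
  have h2 : HasDerivAt (fun u : ℝ => exp (-u⁻¹)) (exp (-v⁻¹) * v⁻¹ ^ 2) v := h1.exp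
  have h3 : HasDerivAt (fun u : ℝ => u ^ 2 * exp (-u⁻¹))
      ((2 : ℕ) * v ^ (2 - 1) * 1 * exp (-v⁻¹) + v ^ 2 * (exp (-v⁻¹) * v⁻¹ ^ 2)) v :=
    ((hasDerivAt_id v).pow 2).mul h2
  have h4 : HasDerivAt cbump
      ((2 : ℕ) * v ^ (2 - 1) * 1 * exp (-v⁻¹) + v ^ 2 * (exp (-v⁻¹) * v⁻¹ ^ 2)) v := by
    refine h3.congr_of_eventuallyEq ?_
    filter_upwards [lt_mem_nhds hv] with u hu
    exact cbump_eq_of_pos hu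
  refine h4.congr_deriv ?_
  field_simp
  push_cast
  ring

/-- `Λ' = 0` on `v < 0` (locally constant). [folklore] -/
theorem hasDerivAt_cbump_of_neg {v : ℝ} (hv : v < 0) : HasDerivAt cbump 0 v := by
  refine (hasDerivAt_const v (0 : ℝ)).congr_of_eventuallyEq ?_
  filter_upwards [gt_mem_nhds hv] with u hu
  exact cbump_of_nonpos hu.le

/-- `Λ` is differentiable. [folklore] -/
theorem differentiable_cbump : Differentiable ℝ cbump := contDiff_cbump.differentiable (by simp)

/-- `Λ'(0) = 0` (a minimum). [folklore] -/
theorem deriv_cbump_zero : deriv cbump 0 = 0 := by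
  apply IsLocalMin.deriv_eq_zero
  filter_upwards with u
  rw [cbump_of_nonpos le_rfl]
  exact cbump_nonneg u

/-- **`Λ' ≥ 0`.** [folklore] -/
theorem deriv_cbump_nonneg (v : ℝ) : 0 ≤ deriv cbump v := by
  rcases lt_trichotomy v 0 with hv | rfl | hv
  · rw [(hasDerivAt_cbump_of_neg hv).deriv]
  · rw [deriv_cbump_zero]
  · rw [(hasDerivAt_cbump_of_pos hv).deriv]
    have := exp_pos (-v⁻¹)
    positivity

/-- `Λ'` is differentiable. [folklore] -/
theorem differentiable_deriv_cbump : Differentiable ℝ (deriv cbump) :=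
  (contDiff_infty_iff_deriv.1 contDiff_cbump).2.differentiable (by simp)

/-- **`Λ''(v) = e^{-1/v} ((2v + 1)/v² + 2)`** for `v > 0`. [folklore] -/
theorem hasDerivAt_deriv_cbump_of_pos {v : ℝ} (hv : 0 < v) :
    HasDerivAt (deriv cbump) (exp (-v⁻¹) * ((2 * v + 1) / v ^ 2 + 2)) v := by
  have hne : v ≠ 0 := hv.ne'
  have h1 : HasDerivAt (fun u : ℝ => -u⁻¹) (v⁻¹ ^ 2) v := by
    have h0 := ((hasDerivAt_id v).inv hne).neg
    have he : -(-(1 : ℝ) / id v ^ 2) = v⁻¹ ^ 2 := by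
      simp only [id_eq, neg_div, neg_neg, one_div, inv_pow]
    exact h0.congr_deriv he
  have h2 : HasDerivAt (fun u : ℝ => exp (-u⁻¹)) (exp (-v⁻¹) * v⁻¹ ^ 2) v := h1.exp
  have h3 : HasDerivAt (fun u : ℝ => exp (-u⁻¹) * (2 * u + 1))
      (exp (-v⁻¹) * v⁻¹ ^ 2 * (2 * v + 1) + exp (-v⁻¹) * (2 * 1)) v :=
    h2.mul (((hasDerivAt_id v).const_mul 2).add_const 1)
  have h4 : HasDerivAt (deriv cbump)
      (exp (-v⁻¹) * v⁻¹ ^ 2 * (2 * v + 1) + exp (-v⁻¹) * (2 * 1)) v := by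
    refine h3.congr_of_eventuallyEq ?_
    filter_upwards [lt_mem_nhds hv] with u hu
    exact (hasDerivAt_cbump_of_pos hu).deriv
  refine h4.congr_deriv ?_
  field_simp

/-- `Λ'' = 0` on `v < 0`. [folklore] -/
theorem hasDerivAt_deriv_cbump_of_neg {v : ℝ} (hv : v < 0) : HasDerivAt (deriv cbump) 0 v := by
  refine (hasDerivAt_const v (0 : ℝ)).congr_of_eventuallyEq ?_
  filter_upwards [gt_mem_nhds hv] with u hu
  exact (hasDerivAt_cbump_of_neg hu).deriv

/-- `Λ''(0) = 0` (`Λ'` has a minimum at `0`). [folklore] -/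
theorem deriv_deriv_cbump_zero : deriv (deriv cbump) 0 = 0 := by
  apply IsLocalMin.deriv_eq_zero
  filter_upwards with u
  rw [deriv_cbump_zero]
  exact deriv_cbump_nonneg u

/-- **`Λ'' ≥ 0`** everywhere. [folklore] -/
theorem deriv_deriv_cbump_nonneg (v : ℝ) : 0 ≤ deriv (deriv cbump) v := by
  rcases lt_trichotomy v 0 with hv | rfl | hv
  · rw [(hasDerivAt_deriv_cbump_of_neg hv).deriv]
  · rw [deriv_deriv_cbump_zero]
  · rw [(hasDerivAt_deriv_cbump_of_pos hv).deriv]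
    have := exp_pos (-v⁻¹)
    positivity

/-- `e^{-4} ≥ 1/60` (from `e^{-1} > 0.36787944116`). [folklore] -/
theorem one_div_sixty_le_exp_neg_four : (1 / 60 : ℝ) ≤ exp (-4) := by
  have h : exp (-4 : ℝ) = exp (-1) ^ 4 := by
    rw [← Real.exp_nat_mul]; norm_num
  rw [h]
  have h1 := Real.exp_neg_one_gt_d9
  have h0 : (0 : ℝ) ≤ 0.36787944116 := by norm_num
  have h2 : (0.36787944116 : ℝ) ^ 4 ≤ exp (-1) ^ 4 := pow_le_pow_left₀ h0 h1.le 4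
  have h3 : (1 / 60 : ℝ) ≤ (0.36787944116 : ℝ) ^ 4 := by norm_num
  exact h3.trans h2

/-- `e^{-4} ≤ 1/32` (from `e^{-1} < 0.3678794412`). [folklore] -/
theorem exp_neg_four_le : exp (-4 : ℝ) ≤ 1 / 32 := by
  have h : exp (-4 : ℝ) = exp (-1) ^ 4 := by
    rw [← Real.exp_nat_mul]; norm_num
  rw [h]
  have h1 := Real.exp_neg_one_lt_d9
  have h2 : exp (-1) ^ 4 ≤ (0.3678794412 : ℝ) ^ 4 :=
    pow_le_pow_left₀ (exp_pos _).le h1.le 4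
  have h3 : (0.3678794412 : ℝ) ^ 4 ≤ 1 / 32 := by norm_num
  exact h2.trans h3

/-- **Lower bound `Λ''(v) ≥ 1/30` for `v ≥ 1/4`** (`e^{-1/v} ≥ e^{-4} ≥ 1/60`, bracket `≥ 2`).
[folklore] -/
theorem deriv_deriv_cbump_ge {v : ℝ} (hv : 1 / 4 ≤ v) : 1 / 30 ≤ deriv (deriv cbump) v := by
  have hv0 : 0 < v := by linarith
  rw [(hasDerivAt_deriv_cbump_of_pos hv0).deriv]
  have h1 : exp (-4) ≤ exp (-v⁻¹) := by
    apply exp_le_exp_of_le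
    have : v⁻¹ ≤ 4 := by rw [inv_le_comm₀ hv0 (by norm_num)]; linarith
    linarith
  have h2 : (2 : ℝ) ≤ (2 * v + 1) / v ^ 2 + 2 := by
    have : 0 ≤ (2 * v + 1) / v ^ 2 := by positivity
    linarith
  have h3 := one_div_sixty_le_exp_neg_four
  have h4 : 0 ≤ exp (-v⁻¹) := (exp_pos _).le
  nlinarith

/-! ### §2 The second derivative of the cut-off `eta` -/

/-- `eta'(4) = 0` (a minimum of `eta`). [folklore] -/
theorem deriv_eta_four : deriv eta 4 = 0 := by
  apply IsLocalMin.deriv_eq_zero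
  filter_upwards with u
  rw [eta_of_le le_rfl]
  exact eta_nonneg u

/-- `eta' ≥ 0` everywhere. [folklore] -/
theorem deriv_eta_nonneg (s : ℝ) : 0 ≤ deriv eta s := by
  rcases lt_trichotomy s 4 with hs | rfl | hs
  · rw [(hasDerivAt_eta_of_lt hs).deriv]
  · rw [deriv_eta_four]
  · exact (deriv_eta_pos hs).le

/-- `eta'` is differentiable. [folklore] -/
theorem differentiable_deriv_eta : Differentiable ℝ (deriv eta) :=
  (contDiff_infty_iff_deriv.1 contDiff_eta).2.differentiable (by simp)

/-- **`eta''(s) = e^{-1/u} (u⁻⁴ - 2u⁻³)`**, `u = s - 4 > 0`. [folklore] -/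
theorem hasDerivAt_deriv_eta {s : ℝ} (hs : 4 < s) :
    HasDerivAt (deriv eta) (exp (-(s - 4)⁻¹) * ((s - 4)⁻¹ ^ 4 - 2 * (s - 4)⁻¹ ^ 3)) s := by
  have hne : s - 4 ≠ 0 := (sub_pos.2 hs).ne'
  have h1 : HasDerivAt (fun u : ℝ => -(u - 4)⁻¹) ((s - 4)⁻¹ ^ 2) s := by
    have h0 : HasDerivAt (fun u : ℝ => -(u - 4)⁻¹) (-(-1 / (s - 4) ^ 2)) s :=
      (((hasDerivAt_id' s).sub_const 4).inv hne).neg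
    have he : -(-1 / (s - 4) ^ 2) = (s - 4)⁻¹ ^ 2 := by
      rw [neg_div, neg_neg, one_div, inv_pow]
    rwa [he] at h0
  have h2 : HasDerivAt (fun u : ℝ => exp (-(u - 4)⁻¹)) (exp (-(s - 4)⁻¹) * (s - 4)⁻¹ ^ 2) s :=
    h1.exp
  have hi : HasDerivAt (fun u : ℝ => (u - 4)⁻¹) (-1 / (s - 4) ^ 2) s :=
    ((hasDerivAt_id' s).sub_const 4).inv hne
  have h3 : HasDerivAt (fun u : ℝ => (u - 4)⁻¹ * (u - 4)⁻¹)
      (-1 / (s - 4) ^ 2 * (s - 4)⁻¹ + (s - 4)⁻¹ * (-1 / (s - 4) ^ 2)) s := hi.mul hi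
  have h4 := h2.mul h3
  have h5 : HasDerivAt (deriv eta)
      (exp (-(s - 4)⁻¹) * (s - 4)⁻¹ ^ 2 * ((s - 4)⁻¹ * (s - 4)⁻¹) +
        exp (-(s - 4)⁻¹) * (-1 / (s - 4) ^ 2 * (s - 4)⁻¹ + (s - 4)⁻¹ * (-1 / (s - 4) ^ 2))) s := by
    refine h4.congr_of_eventuallyEq ?_
    filter_upwards [lt_mem_nhds hs] with u hu
    show deriv eta u = exp (-(u - 4)⁻¹) * ((u - 4)⁻¹ * (u - 4)⁻¹)
    rw [(hasDerivAt_eta hu).deriv, sq]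
  refine h5.congr_deriv ?_
  have ht : -1 / (s - 4) ^ 2 = -((s - 4)⁻¹ ^ 2) := by rw [neg_div, one_div, inv_pow]
  rw [ht]
  ring

/-- `eta'' = 0` on `s < 4`. [folklore] -/
theorem hasDerivAt_deriv_eta_of_lt {s : ℝ} (hs : s < 4) : HasDerivAt (deriv eta) 0 s := by
  refine (hasDerivAt_const s (0 : ℝ)).congr_of_eventuallyEq ?_
  filter_upwards [gt_mem_nhds hs] with u hu
  exact (hasDerivAt_eta_of_lt hu).deriv

/-- `eta''(4) = 0` (`eta'` has a minimum at `4`). [folklore] -/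
theorem deriv_deriv_eta_four : deriv (deriv eta) 4 = 0 := by
  apply IsLocalMin.deriv_eq_zero
  filter_upwards with u
  rw [deriv_eta_four]
  exact deriv_eta_nonneg u

/-- **`eta'' ≥ 0` on `s ≤ 9/2`** (`u ≤ 1/2`: `u⁻⁴ - 2u⁻³ = u⁻⁴(1 - 2u) ≥ 0`). [folklore] -/
theorem deriv_deriv_eta_nonneg_of_le {s : ℝ} (hs : s ≤ 9 / 2) : 0 ≤ deriv (deriv eta) s := by
  rcases lt_trichotomy s 4 with h4 | rfl | h4
  · rw [(hasDerivAt_deriv_eta_of_lt h4).deriv]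
  · rw [deriv_deriv_eta_four]
  · rw [(hasDerivAt_deriv_eta h4).deriv]
    have hu : 0 < s - 4 := sub_pos.2 h4
    have hu2 : s - 4 ≤ 1 / 2 := by linarith
    have hinv : 2 ≤ (s - 4)⁻¹ := by rw [le_inv_comm₀ (by norm_num) hu]; linarith
    have hkey : 0 ≤ (s - 4)⁻¹ ^ 4 - 2 * (s - 4)⁻¹ ^ 3 := by
      have h0 : 0 ≤ (s - 4)⁻¹ := (inv_pos.2 hu).le
      have : (s - 4)⁻¹ ^ 4 - 2 * (s - 4)⁻¹ ^ 3 = (s - 4)⁻¹ ^ 3 * ((s - 4)⁻¹ - 2) := by ring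
      rw [this]
      exact mul_nonneg (by positivity) (by linarith)
    exact mul_nonneg (exp_pos _).le hkey

/-- **`eta'' ≥ -32` on `s ≥ 9/2`** (`u ≥ 1/2`: `e^{-1/u} ≤ 1`, `u⁻⁴ ≤ 16`, `2u⁻³ ≤ 16`).
[folklore] -/
theorem deriv_deriv_eta_ge_of_ge {s : ℝ} (hs : 9 / 2 ≤ s) : -32 ≤ deriv (deriv eta) s := by
  have h4 : 4 < s := by linarith
  rw [(hasDerivAt_deriv_eta h4).deriv]
  have hu : 0 < s - 4 := sub_pos.2 h4
  have hinv : (s - 4)⁻¹ ≤ 2 := by rw [inv_le_comm₀ hu (by norm_num)]; linarith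
  have h0 : 0 ≤ (s - 4)⁻¹ := (inv_pos.2 hu).le
  have he1 : exp (-(s - 4)⁻¹) ≤ 1 := by
    rw [← Real.exp_zero]; exact exp_le_exp_of_le (by linarith)
  have he0 : 0 ≤ exp (-(s - 4)⁻¹) := (exp_pos _).le
  have h3 : (s - 4)⁻¹ ^ 3 ≤ 8 := by
    have := pow_le_pow_left₀ h0 hinv 3
    have h8 : (2 : ℝ) ^ 3 = 8 := by norm_num
    rwa [h8] at this
  have hlow : -16 ≤ (s - 4)⁻¹ ^ 4 - 2 * (s - 4)⁻¹ ^ 3 := by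
    have : 0 ≤ (s - 4)⁻¹ ^ 4 := by positivity
    linarith
  -- `e · X ≥ -32` from `0 ≤ e ≤ 1` and `X ≥ -16`: `e (X + 16) ≥ 0`
  have hprod := mul_nonneg he0 (show (0 : ℝ) ≤ (s - 4)⁻¹ ^ 4 - 2 * (s - 4)⁻¹ ^ 3 + 16 by linarith)
  nlinarith

/-! ### §3 The convex profile `Θ = eta + 2000 Λ(· - 17/4)` -/

/-- **The convex profile** `Θ(s) = eta(s) + 2000 · Λ(s - 17/4)`. [folklore] -/
def convexProfile (s : ℝ) : ℝ := eta s + 2000 * cbump (s - 17 / 4)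

/-- `Θ` is smooth. [folklore] -/
theorem contDiff_convexProfile : ContDiff ℝ ∞ convexProfile :=
  contDiff_eta.add (contDiff_const.mul (contDiff_cbump.comp (contDiff_id.sub contDiff_const)))

/-- `Θ = eta` on `s ≤ 17/4`. [folklore] -/
theorem convexProfile_of_le {s : ℝ} (hs : s ≤ 17 / 4) : convexProfile s = eta s := by
  simp [convexProfile, cbump_of_nonpos (show s - 17 / 4 ≤ 0 by linarith)]

/-- `Θ = 0` on `s ≤ 4`. [folklore] -/
theorem convexProfile_of_le_four {s : ℝ} (hs : s ≤ 4) : convexProfile s = 0 := by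
  rw [convexProfile_of_le (by linarith), eta_of_le hs]

/-- `Θ ≥ eta`. [folklore] -/
theorem eta_le_convexProfile (s : ℝ) : eta s ≤ convexProfile s := by
  have := cbump_nonneg (s - 17 / 4)
  simp only [convexProfile]
  linarith

/-- `Θ(17/4) = e^{-4} ≤ 1/32`. [folklore] -/
theorem convexProfile_seventeen_quarters_le : convexProfile (17 / 4) ≤ 1 / 32 := by
  rw [convexProfile_of_le le_rfl, eta_eq_exp (by norm_num)]
  have : (-(17 / 4 - 4 : ℝ)⁻¹) = -4 := by norm_num
  rw [this]
  exact exp_neg_four_le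

/-- The derivative of `Θ`: `Θ'(s) = eta'(s) + 2000 Λ'(s - 17/4)`. [folklore] -/
theorem hasDerivAt_convexProfile (s : ℝ) :
    HasDerivAt convexProfile (deriv eta s + 2000 * deriv cbump (s - 17 / 4)) s := by
  have h1 : HasDerivAt eta (deriv eta s) s := ((contDiff_eta.differentiable (by simp)) s).hasDerivAt
  have h2 : HasDerivAt (fun u : ℝ => cbump (u - 17 / 4)) (deriv cbump (s - 17 / 4) * 1) s :=
    (differentiable_cbump _).hasDerivAt.comp s ((hasDerivAt_id s).sub_const _)
  have h := h1.add ((h2.const_mul 2000))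
  refine h.congr_deriv ?_
  ring

/-- `deriv Θ` as a function. [folklore] -/
theorem deriv_convexProfile_eq :
    deriv convexProfile = fun s => deriv eta s + 2000 * deriv cbump (s - 17 / 4) :=
  funext fun s => (hasDerivAt_convexProfile s).deriv

/-- **`Θ' ≥ 0`.** [folklore] -/
theorem deriv_convexProfile_nonneg (s : ℝ) : 0 ≤ deriv convexProfile s := by
  rw [(hasDerivAt_convexProfile s).deriv]
  have h1 := deriv_eta_nonneg s
  have h2 := deriv_cbump_nonneg (s - 17 / 4)
  positivity

/-- **`Θ' > 0` beyond the flat region** (`s > 4`). [folklore] -/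
theorem deriv_convexProfile_pos {s : ℝ} (hs : 4 < s) : 0 < deriv convexProfile s := by
  rw [(hasDerivAt_convexProfile s).deriv]
  have h1 := deriv_eta_pos hs
  have h2 := deriv_cbump_nonneg (s - 17 / 4)
  positivity

/-- The second derivative of `Θ`: `Θ''(s) = eta''(s) + 2000 Λ''(s - 17/4)`. [folklore] -/
theorem hasDerivAt_deriv_convexProfile (s : ℝ) :
    HasDerivAt (deriv convexProfile)
      (deriv (deriv eta) s + 2000 * deriv (deriv cbump) (s - 17 / 4)) s := by
  rw [deriv_convexProfile_eq]
  have h1 : HasDerivAt (deriv eta) (deriv (deriv eta) s) s :=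
    (differentiable_deriv_eta s).hasDerivAt
  have h2 : HasDerivAt (fun u : ℝ => deriv cbump (u - 17 / 4))
      (deriv (deriv cbump) (s - 17 / 4) * 1) s :=
    (differentiable_deriv_cbump _).hasDerivAt.comp s ((hasDerivAt_id s).sub_const _)
  have h := h1.add (h2.const_mul 2000)
  refine h.congr_deriv ?_
  ring

/-- **`Θ'' ≥ 0`**: for `s ≤ 9/2` both `eta''` and `Λ''` are `≥ 0`; for `9/2 ≤ s`,
`eta'' ≥ -32` and `2000 Λ''(s - 17/4) ≥ 2000/30 > 32`. [folklore] -/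
theorem deriv_deriv_convexProfile_nonneg (s : ℝ) :
    0 ≤ deriv (deriv convexProfile) s := by
  rw [(hasDerivAt_deriv_convexProfile s).deriv]
  have hΛ := deriv_deriv_cbump_nonneg (s - 17 / 4)
  rcases le_or_gt s (9 / 2) with h | h
  · have hη := deriv_deriv_eta_nonneg_of_le h
    positivity
  · have hη := deriv_deriv_eta_ge_of_ge h.le
    have hΛ' := deriv_deriv_cbump_ge (show (1 / 4 : ℝ) ≤ s - 17 / 4 by linarith)
    linarith

/-- **The plurisubharmonicity coefficient of `Θ(‖x‖²)` is non-negative**: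
`Θ'(s) + s Θ''(s) ≥ 0` for `0 ≤ s` (the coefficient of
`FlatLeviNormSq.levi_comp_norm_sq_of_linear`). [folklore] -/
theorem levi_coeff_convexProfile_nonneg {s : ℝ} (h0 : 0 ≤ s) :
    0 ≤ deriv convexProfile s + s * deriv (deriv convexProfile) s :=
  add_nonneg (deriv_convexProfile_nonneg s) (mul_nonneg h0 (deriv_deriv_convexProfile_nonneg s))

end LefschetzBase

end Literature.Topology.FourManifolds

end
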